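import Summits.QuantumFields.YangMills.Theorems.UnitScaleTiltHalvingP1FlatCoreFrameLinLipschitz
import Summits.QuantumFields.BalabanUV.T4Continuum.Support.BlockAverageLoopLog
import HarnessLib

/-!
# The effective-gauge tower in log coordinates: the REALITY row `C(−μ⋆) = −C(μ)⋆` (J-N05♭ `core′`, induction brick F4)

Sub-problem `YangMills` of summit `QuantumFields`; route `UnitScaleTilt`, line H = `BirthV10.stub_halvingStep`, pillar P1♭ `core′`
(LEAD-H T2♭-PLAN v1.1; rulings L-3/L-4/L-5).  Helper file (`--supports stmt-QuantumFields-19200 --as helper`); it closes no item.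
HONEST LABEL: YM₃ on `T³` is rung R3 of the ladder, NOT the Clay problem; nothing here is a mass-gap statement.

## What this file adds

The third row `hCreal` of the family contraction (✓`B8SectEKLevelFamilyHc.exists_Hc_of_family`, socket ✓`hFP_kLevel_family_RD`):
`Cfam j (fun x => −star (μ x)) y = −star (Cfam j μ y)` — for the nonlinear part `C(μ) = log κ_k[μ](y) − (Q′_k μ)(y)` of the
effective-gauge tower of the double-bar tower of a UNITARY-stair field `W` in a C⋆-algebra.  Mechanism: the involution `u ↦ (u⋆)⁻¹` of the
unit group is a multiplicative homomorphism fixing unitaries; it maps `exp ∘ μ` to `exp ∘ (−μ⋆)`, commutes with the nonlinear means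
`eml` near `1` (`log((u⋆)⁻¹) = −(log u)⋆`, §1, with ✓`BlockAverageLoopLog.mlog_units_inv`) and hence with every step of the recursion (§2, ✓`effGauge_step_eq_eml`); the block
site-averages are real-linear (§3).  §4 ★★★ `Cnl_negStar`.

[cite: Balaban1985RegularSpaces, Sect. E (1.111), (1.116) pp.95-96 («H₁′⋆ transforms Hermitian into Hermitian»); Balaban1985Averaging, (97)-(100) p.32, (110) p.34]
-/

noncomputable section

open NormedSpace
open Literature.MathematicalPhysics.QuantumFieldTheory.Balaban1983to89
open T4Continuum BlockAveraging ExpMeanLog MatrixLog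
open B10Eq27TorusAxialLog (holT gaugeActT)
open B7TransferAnalyticMean (meanCLM meanCLM_apply)
open B7Prop1Explicit (units_val_inv_eq_exp_neg)
open LatticeFieldCalculus (siteAvg siteAvgIter)
open Summit.QuantumFields.YangMills.Theorems.Prop8ChartDoubleBar (vframeU dbarIterU)
open Summit.QuantumFields.YangMills.Theorems.P1FlatCoreFrameLin (coe_vframeU_eq_exp_meanCLM)
open Summit.QuantumFields.YangMills.Theorems.P1FlatCoreFrameLinTower (effGauge_step_eq_eml)
open Summit.QuantumFields.YangMills.Theorems.P1FlatCoreFrameLinLipschitz (val_unit_eml val_inv_unit_eml)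
open Summit.QuantumFields.BalabanUV.T4Continuum.BlockAverageLoopLog (mlog_units_inv)

namespace Summit.QuantumFields.YangMills.Theorems.P1FlatCoreFrameLinReal

variable {𝔸 : Type*} [CStarAlgebra 𝔸]

/-! ## §1 The involution `u ↦ (u⋆)⁻¹` and the logarithm -/

section Star

/-- `log (x⋆) = (log x)⋆` within `1/3` of `1` (`x⋆ = (e^{log x})⋆ = e^{(log x)⋆}`, Mathlib `star_exp`; `‖(log x)⋆‖ = ‖log x‖ ≤ 2/3 < ln 2`).
[cite: Balaban1985Averaging, (21) p.21] -/
theorem mlog_star_of_le {x : 𝔸} (hx : ‖x - 1‖ ≤ 1 / 3) : mlog (star x) = star (mlog x) := by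
  have hx1 : ‖x - 1‖ < 1 := hx.trans_lt (by norm_num)
  have hX : ‖mlog x‖ ≤ 2 / 3 := (norm_mlog_le_two_mul (hx.trans (by norm_num))).trans (by linarith)
  have hs : star x = exp (star (mlog x)) := by
    calc star x = star (exp (mlog x)) := by rw [exp_mlog hx1]
      _ = exp (star (mlog x)) := star_exp _
  rw [hs]
  exact B7BlockAvgLog.mlog_exp (by rw [norm_star]; linarith [Real.log_two_gt_d9])

/-- A unit within `1/12` of `1` has its inverse within `1/3` of `1` (`u⁻¹ = e^{−log u}`, `‖log u‖ ≤ 1/6`, `e^{1/6} − 1 ≤ 1/3`). [folklore] -/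
theorem norm_units_inv_sub_one_le {u : 𝔸ˣ} (hu : ‖(u : 𝔸) - 1‖ ≤ 1 / 12) : ‖(((u⁻¹ : 𝔸ˣ) : 𝔸)) - 1‖ ≤ 1 / 3 := by
  have hX : ‖mlog (u : 𝔸)‖ ≤ 1 / 6 := (norm_mlog_le_two_mul (hu.trans (by norm_num))).trans (by linarith)
  rw [units_val_inv_eq_exp_neg (exp_mlog (hu.trans_lt (by norm_num))).symm]
  have h1 := B7Transfer.norm_exp_sub_one_le_of_le (-mlog (u : 𝔸)) (β := 1 / 6) (by rwa [norm_neg])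
  have h2 : Real.exp (1 / 6 : ℝ) - 1 ≤ 1 / 3 := by
    have h := Real.abs_exp_sub_one_le (x := (1 / 6 : ℝ)) (by rw [abs_of_nonneg (by norm_num)]; norm_num)
    rw [abs_of_nonneg (by norm_num : (0 : ℝ) ≤ 1 / 6)] at h
    linarith [le_abs_self (Real.exp (1 / 6 : ℝ) - 1)]
  exact h1.trans h2

/-- **★ THE INVOLUTION `u ↦ (u⋆)⁻¹` IS `log ↦ −log⋆`**: `log ((u⁻¹)⋆) = −(log u)⋆` for a unit within `1/12` of `1`.
[cite: Balaban1985RegularSpaces, (1.111) p.95; Balaban1985Averaging, (21) p.21] -/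
theorem mlog_star_units_inv {u : 𝔸ˣ} (hu : ‖(u : 𝔸) - 1‖ ≤ 1 / 12) :
    mlog (star (((u⁻¹ : 𝔸ˣ) : 𝔸))) = -star (mlog (u : 𝔸)) := by
  rw [mlog_star_of_le (norm_units_inv_sub_one_le hu), mlog_units_inv (hu.trans (by norm_num)), star_neg]

/-- For a UNITARY unit near `1`: `log u⋆ ... ` — the inverse is the adjoint, `(u⁻¹ : 𝔸) = u⋆`. [folklore] -/
theorem units_val_inv_eq_star {u : 𝔸ˣ} (hu : (u : 𝔸) ∈ unitary 𝔸) : (((u⁻¹ : 𝔸ˣ) : 𝔸)) = star (u : 𝔸) :=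
  Units.inv_eq_of_mul_eq_one_right (Unitary.mul_star_self_of_mem hu)

/-- The mean commutes with the adjoint (its weights `|I|⁻¹` are real). [folklore] -/
theorem star_meanCLM {ι : Type*} [Fintype ι] (f : ι → 𝔸) : star (meanCLM ι 𝔸 f) = meanCLM ι 𝔸 fun i => star (f i) := by
  rw [meanCLM_apply, meanCLM_apply, star_smul, star_sum]
  congr 1
  simp

end Star

/-! ## §2 The tower of `−μ⋆` is the star-inverse of the tower of `μ` -/

section Tower

variable {P : Params}

/-- **★★ THE EFFECTIVE-GAUGE TOWER INTERTWINES `μ ↦ −μ⋆` WITH `u ↦ (u⋆)⁻¹`**: for a tower-valued function `κf` of the bottom gauge obeying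
the recursion of ✓`exists_effGauge` for the double-bar tower of `W` with `κf m 0 = exp ∘ m`, if every centre stair of every `U̿^{(i)}W`
(`i < k`) is UNITARY and within `1/12` of `1`, and every stair-times-relative-factor `X_i(Γ)·κ_i(x)⁻¹κ_i(ȳ)` of the `μ`-tower is within
`1/12` of `1`, then for all `i ≤ k`:  `κf(−μ⋆)_i(x) = (κf(μ)_i(x)⁻¹)⋆` and `κf(−μ⋆)_i(x)⁻¹ = (κf(μ)_i(x))⋆` (level by level through
✓`effGauge_step_eq_eml`: `log` of the star-inverse family is `−log⋆`, the mean commutes with `⋆`, `exp` intertwines by `star_exp`).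
[cite: Balaban1985RegularSpaces, (1.111), (1.116) pp.95-96; Balaban1985Averaging, (97)-(100) p.32, (110) p.34] -/
theorem effGauge_negStar (W : GaugeField P 0 𝔸ˣ) (κf : (Site P 0 → 𝔸) → (i : ℕ) → GaugeTransf P i 𝔸ˣ)
    (hs : ∀ (m : Site P 0 → 𝔸) (i : ℕ) (y : Site P (i + 1)),
      κf m (i + 1) y = (vframeU (gaugeActT (κf m i) (dbarIterU i W)) y)⁻¹ * κf m i (emb y) * vframeU (dbarIterU i W) y)
    (h0 : ∀ (m : Site P 0 → 𝔸) (x : Site P 0), ((κf m 0 x : 𝔸ˣ) : 𝔸) = exp (m x))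
    (μ : Site P 0 → 𝔸) (k : ℕ)
    (hWu : ∀ i < k, ∀ (y : Site P (i + 1)) (idx : Idx P),
      ((holT (dbarIterU i W) (emb y) (stairWord idx.2.1 (off idx.1)) : 𝔸ˣ) : 𝔸) ∈ unitary 𝔸)
    (hWs : ∀ i < k, ∀ (y : Site P (i + 1)) (idx : Idx P),
      ‖((holT (dbarIterU i W) (emb y) (stairWord idx.2.1 (off idx.1)) : 𝔸ˣ) : 𝔸) - 1‖ ≤ 1 / 12)
    (hdisc : ∀ i < k, ∀ (y : Site P (i + 1)) (idx : Idx P),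
      ‖((holT (dbarIterU i W) (emb y) (stairWord idx.2.1 (off idx.1)) *
          ((κf μ i (walkEnd (emb y) (stairWord idx.2.1 (off idx.1))))⁻¹ * κf μ i (emb y)) : 𝔸ˣ) : 𝔸) - 1‖ ≤ 1 / 12) :
    ∀ i ≤ k, ∀ x : Site P i,
      ((κf (fun z => -star (μ z)) i x : 𝔸ˣ) : 𝔸) = star ((((κf μ i x)⁻¹ : 𝔸ˣ) : 𝔸)) ∧
        ((((κf (fun z => -star (μ z)) i x)⁻¹ : 𝔸ˣ) : 𝔸)) = star ((κf μ i x : 𝔸ˣ) : 𝔸) := by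
  intro i
  induction i with
  | zero =>
    intro _ x
    refine ⟨?_, ?_⟩
    · rw [h0, units_val_inv_eq_exp_neg (h0 μ x), star_exp, star_neg]
    · rw [units_val_inv_eq_exp_neg (h0 _ x), h0, star_exp, neg_neg]
  | succ i ih =>
    intro hik y
    have hi : i < k := Nat.lt_of_succ_le hik
    have ihi := ih hi.le
    -- the two eml families: `fam′ = (fam⁻¹)⋆` termwise
    have hfam : ∀ idx : Idx P,
        ((holT (dbarIterU i W) (emb y) (stairWord idx.2.1 (off idx.1)) : 𝔸ˣ) : 𝔸) *
            ((((κf (fun z => -star (μ z)) i (walkEnd (emb y) (stairWord idx.2.1 (off idx.1))))⁻¹ *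
                κf (fun z => -star (μ z)) i (emb y) : 𝔸ˣ)) : 𝔸) =
          star (((((holT (dbarIterU i W) (emb y) (stairWord idx.2.1 (off idx.1)) *
            ((κf μ i (walkEnd (emb y) (stairWord idx.2.1 (off idx.1))))⁻¹ * κf μ i (emb y)))⁻¹ : 𝔸ˣ)) : 𝔸)) := by
      intro idx
      rw [Units.val_mul, (ihi _).2, (ihi _).1, mul_inv_rev, mul_inv_rev, inv_inv, Units.val_mul, Units.val_mul,
        units_val_inv_eq_star (hWu i hi y idx), star_mul, star_mul, star_star]
    have hlog : ∀ idx : Idx P,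
        mlog (((holT (dbarIterU i W) (emb y) (stairWord idx.2.1 (off idx.1)) : 𝔸ˣ) : 𝔸) *
            ((((κf (fun z => -star (μ z)) i (walkEnd (emb y) (stairWord idx.2.1 (off idx.1))))⁻¹ *
                κf (fun z => -star (μ z)) i (emb y) : 𝔸ˣ)) : 𝔸)) =
          -star (mlog (((holT (dbarIterU i W) (emb y) (stairWord idx.2.1 (off idx.1)) : 𝔸ˣ) : 𝔸) *
            ((((κf μ i (walkEnd (emb y) (stairWord idx.2.1 (off idx.1))))⁻¹ * κf μ i (emb y) : 𝔸ˣ)) : 𝔸))) := by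
      intro idx
      rw [hfam idx, mlog_star_units_inv (hdisc i hi y idx), Units.val_mul]
    -- the exponents: `M′ = −M⋆`
    have hM : (meanCLM (Idx P) 𝔸 fun idx : Idx P =>
        mlog (((holT (dbarIterU i W) (emb y) (stairWord idx.2.1 (off idx.1)) : 𝔸ˣ) : 𝔸) *
            ((((κf (fun z => -star (μ z)) i (walkEnd (emb y) (stairWord idx.2.1 (off idx.1))))⁻¹ *
                κf (fun z => -star (μ z)) i (emb y) : 𝔸ˣ)) : 𝔸))) =
          -star (meanCLM (Idx P) 𝔸 fun idx : Idx P =>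
            mlog (((holT (dbarIterU i W) (emb y) (stairWord idx.2.1 (off idx.1)) : 𝔸ˣ) : 𝔸) *
              ((((κf μ i (walkEnd (emb y) (stairWord idx.2.1 (off idx.1))))⁻¹ * κf μ i (emb y) : 𝔸ˣ)) : 𝔸))) := by
      rw [star_meanCLM, ← map_neg]
      congr 1
      funext idx
      rw [Pi.neg_apply, hlog idx]
    -- the frame `v = v(X_i)(y)` is unitary: `(v⁻¹)⋆ = v`
    have hH : (meanCLM (Idx P) 𝔸 fun idx : Idx P =>
        mlog (((holT (dbarIterU i W) (emb y) (stairWord idx.2.1 (off idx.1)) : 𝔸ˣ) : 𝔸))) =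
          -star (meanCLM (Idx P) 𝔸 fun idx : Idx P =>
            mlog (((holT (dbarIterU i W) (emb y) (stairWord idx.2.1 (off idx.1)) : 𝔸ˣ) : 𝔸))) := by
      rw [star_meanCLM, ← map_neg]
      congr 1
      funext idx
      rw [Pi.neg_apply, ← mlog_star_of_le ((hWs i hi y idx).trans (by norm_num)), ← units_val_inv_eq_star (hWu i hi y idx),
        mlog_units_inv ((hWs i hi y idx).trans (by norm_num)), neg_neg]
    have hv : star ((((vframeU (dbarIterU i W) y)⁻¹ : 𝔸ˣ) : 𝔸)) = ((vframeU (dbarIterU i W) y : 𝔸ˣ) : 𝔸) := by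
      rw [units_val_inv_eq_exp_neg (coe_vframeU_eq_exp_meanCLM (dbarIterU i W) y), coe_vframeU_eq_exp_meanCLM, star_exp,
        star_neg, ← neg_eq_iff_eq_neg.mpr hH, neg_neg]
    have hv' : star ((vframeU (dbarIterU i W) y : 𝔸ˣ) : 𝔸) = ((((vframeU (dbarIterU i W) y)⁻¹ : 𝔸ˣ) : 𝔸)) := by
      rw [← hv, star_star]
    refine ⟨?_, ?_⟩
    · rw [effGauge_step_eq_eml W _ (hs _) i y, effGauge_step_eq_eml W _ (hs _) i y, Units.val_mul, Units.val_mul,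
        mul_inv_rev, mul_inv_rev, inv_inv, Units.val_mul, Units.val_mul, star_mul, star_mul, (ihi _).1, val_inv_unit_eml,
        val_unit_eml, star_exp, hM, neg_neg, hv]
    · rw [effGauge_step_eq_eml W _ (hs _) i y, effGauge_step_eq_eml W _ (hs _) i y, mul_inv_rev, mul_inv_rev, inv_inv,
        Units.val_mul, Units.val_mul, Units.val_mul, Units.val_mul, star_mul, star_mul, (ihi _).2, val_unit_eml,
        val_inv_unit_eml, star_exp, star_neg, hM, hv']

end Tower

/-! ## §3 The block site-averages are real-linear: `Q′_j(−μ⋆) = −(Q′_j μ)⋆` -/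

section Linear

variable {P : Params}

/-- `Q′_j (−μ⋆) = −(Q′_j μ)⋆` (real weights `L^{−d}`). [cite: Balaban1984PropagatorsI, (1.20) p.20] -/
theorem siteAvgIter_negStar (μ : Site P 0 → 𝔸) :
    ∀ (j : ℕ) (y : Site P j), siteAvgIter j (fun z => -star (μ z)) y = -star (siteAvgIter j μ y)
  | 0, y => rfl
  | j + 1, y => by
    show siteAvg (siteAvgIter j fun z => -star (μ z)) y = -star (siteAvg (siteAvgIter j μ) y)
    have hfun : (siteAvgIter j fun z => -star (μ z)) = fun x => -star (siteAvgIter j μ x) :=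
      funext fun x => siteAvgIter_negStar μ j x
    rw [hfun]
    simp only [LatticeFieldCalculus.siteAvg, star_smul, star_trivial, star_sum, smul_neg, Finset.sum_neg_distrib]

end Linear

/-! ## §4 The reality row -/

section Real

variable {P : Params}

/-- **★★★ THE REALITY ROW `C(−μ⋆) = −C(μ)⋆` OF THE EFFECTIVE-GAUGE TOWER** (the `hCreal` hypothesis of
✓`B8SectEKLevelFamilyHc.exists_Hc_of_family` / ✓`hFP_kLevel_family_RD`, in torus letters): under the hypotheses of ✓`effGauge_negStar`
and `‖κf(μ)_k(y) − 1‖ ≤ 1/12`, the nonlinear part `C(m) := log κf(m)_k(y) − (Q′_k m)(y)` satisfies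
`C(−μ⋆) = −(C μ)⋆` — so `C` maps Hermitian `λ = iμ`-data to Hermitian data (print: «`H₁′⋆` transforms Hermitian into Hermitian»).
[cite: Balaban1985RegularSpaces, Sect. E (1.111), (1.116) pp.95-96] -/
theorem Cnl_negStar (W : GaugeField P 0 𝔸ˣ) (κf : (Site P 0 → 𝔸) → (i : ℕ) → GaugeTransf P i 𝔸ˣ)
    (hs : ∀ (m : Site P 0 → 𝔸) (i : ℕ) (y : Site P (i + 1)),
      κf m (i + 1) y = (vframeU (gaugeActT (κf m i) (dbarIterU i W)) y)⁻¹ * κf m i (emb y) * vframeU (dbarIterU i W) y)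
    (h0 : ∀ (m : Site P 0 → 𝔸) (x : Site P 0), ((κf m 0 x : 𝔸ˣ) : 𝔸) = exp (m x))
    (μ : Site P 0 → 𝔸) (k : ℕ)
    (hWu : ∀ i < k, ∀ (y : Site P (i + 1)) (idx : Idx P),
      ((holT (dbarIterU i W) (emb y) (stairWord idx.2.1 (off idx.1)) : 𝔸ˣ) : 𝔸) ∈ unitary 𝔸)
    (hWs : ∀ i < k, ∀ (y : Site P (i + 1)) (idx : Idx P),
      ‖((holT (dbarIterU i W) (emb y) (stairWord idx.2.1 (off idx.1)) : 𝔸ˣ) : 𝔸) - 1‖ ≤ 1 / 12)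
    (hdisc : ∀ i < k, ∀ (y : Site P (i + 1)) (idx : Idx P),
      ‖((holT (dbarIterU i W) (emb y) (stairWord idx.2.1 (off idx.1)) *
          ((κf μ i (walkEnd (emb y) (stairWord idx.2.1 (off idx.1))))⁻¹ * κf μ i (emb y)) : 𝔸ˣ) : 𝔸) - 1‖ ≤ 1 / 12)
    (y : Site P k) (htop : ‖((κf μ k y : 𝔸ˣ) : 𝔸) - 1‖ ≤ 1 / 12) :
    mlog ((κf (fun z => -star (μ z)) k y : 𝔸ˣ) : 𝔸) - siteAvgIter k (fun z => -star (μ z)) y =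
      -star (mlog ((κf μ k y : 𝔸ˣ) : 𝔸) - siteAvgIter k μ y) := by
  rw [(effGauge_negStar W κf hs h0 μ k hWu hWs hdisc k le_rfl y).1, mlog_star_units_inv htop, siteAvgIter_negStar μ k y,
    star_sub]
  abel

end Real

/-! ## §5 Discharging the disc conditions from the size row (for the (T4b) instance) -/

section Disc

variable {𝔹 : Type*} [NormedRing 𝔹] [NormedAlgebra ℂ 𝔹] [CompleteSpace 𝔹] {P : Params} {j : ℕ}

open B12Membership313II (bchLog exp_bchLog norm_expMul_sub_one_lt_one norm_exp_mul_exp_sub_one_le_of_le)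
open Summit.QuantumFields.YangMills.Theorems.P1FlatCoreFrameLinOsc (norm_bchLog_le_two_mul)

/-- `e^{1/24} − 1 ≤ 1/12`. [folklore] -/
theorem exp_twentyFourth_sub_one_le : Real.exp (1 / 24 : ℝ) - 1 ≤ 1 / 12 := by
  have h := Real.abs_exp_sub_one_le (x := (1 / 24 : ℝ)) (by rw [abs_of_nonneg (by norm_num)]; norm_num)
  rw [abs_of_nonneg (by norm_num : (0 : ℝ) ≤ 1 / 24)] at h
  linarith [le_abs_self (Real.exp (1 / 24 : ℝ) - 1)]

/-- **THE STAIR DISC CONDITION `≤ 1/12` FROM THE SIZE ROW** (pointwise: `κ = e^{l}` AT the two sites `x`, `z` only, `‖l‖ ≤ a″` there), stair `hol` within `δ ≤ 1/2` of `1`,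
`2δ + 4a″ ≤ 1/24` ⇒ `‖hol·κ(x)⁻¹κ(z) − 1‖ ≤ 1/12` (the `hdisc` of ✓`effGauge_negStar`). [cite: Balaban1985Averaging, (21) p.21, (110) p.34] -/
theorem norm_stairRel_sub_one_le_twelfth (hol : 𝔹ˣ) (κ : GaugeTransf P j 𝔹ˣ) (l : Site P j → 𝔹) (x z : Site P j)
    (hκx : ((κ x : 𝔹ˣ) : 𝔹) = exp (l x)) (hκz : ((κ z : 𝔹ˣ) : 𝔹) = exp (l z)) {δ a'' : ℝ} (hH : ‖(hol : 𝔹) - 1‖ ≤ δ)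
    (hx : ‖l x‖ ≤ a'') (hz : ‖l z‖ ≤ a'') (hδ : δ ≤ 1 / 2) (hr : 2 * δ + 4 * a'' ≤ 1 / 24) :
    ‖(((hol * ((κ x)⁻¹ * κ z)) : 𝔹ˣ) : 𝔹) - 1‖ ≤ 1 / 12 := by
  have ha : 0 ≤ a'' := (norm_nonneg _).trans hx
  have hδ0 : 0 ≤ δ := (norm_nonneg _).trans hH
  have h1 : ‖(hol : 𝔹) - 1‖ < 1 := hH.trans_lt (by linarith)
  have hHn : ‖mlog (hol : 𝔹)‖ ≤ 2 * δ := (norm_mlog_le_two_mul (hH.trans hδ)).trans (by linarith)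
  have hrel : ((((κ x)⁻¹ * κ z) : 𝔹ˣ) : 𝔹) = exp (-(l x)) * exp (l z) := by
    rw [Units.val_mul, units_val_inv_eq_exp_neg hκx, hκz]
  have h2 : ‖-(l x)‖ + ‖l z‖ ≤ 1 / 4 := by rw [norm_neg]; linarith
  have hSn : ‖bchLog (-(l x)) (l z)‖ ≤ 2 * (a'' + a'') := norm_bchLog_le_two_mul (by rwa [norm_neg]) hz (by linarith)
  rw [Units.val_mul, hrel, ← exp_bchLog (norm_expMul_sub_one_lt_one h2)]
  conv_lhs => rw [← exp_mlog h1]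
  exact (norm_exp_mul_exp_sub_one_le_of_le (s := 1 / 24) (by linarith)).trans exp_twentyFourth_sub_one_le

/-- **THE TOP DISC CONDITION `≤ 1/12`**: `‖l‖ ≤ 1/24 ⇒ ‖e^{l} − 1‖ ≤ 1/12` (the `htop` of ✓`Cnl_negStar` for `κ_k(y) = e^{log κ_k(y)}`). [folklore] -/
theorem norm_exp_sub_one_le_twelfth (l : 𝔹) (hl : ‖l‖ ≤ 1 / 24) : ‖exp l - 1‖ ≤ 1 / 12 :=
  (B7Transfer.norm_exp_sub_one_le_of_le l hl).trans exp_twentyFourth_sub_one_le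

end Disc

end Summit.QuantumFields.YangMills.Theorems.P1FlatCoreFrameLinReal

end
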